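import Summits.ResolutionOfSingularities.ResolutionOfSingularities.Theses.IndSmooth
import Literature.AlgebraicGeometry.Resolution.RankOneReductionProofs
import Literature.AlgebraicGeometry.Resolution.RegularLocalRingsNormal

/-!
# Line `birth` of crux `IndSmooth.SmoothToUniformizing`: the flatness hypothesis of
# `stub_valuativeJacobian` is load-bearing — a model need not be regular at the centre
# (negative-side support for crux `stmt-ResolutionOfSingularities-16088`, refuter / cdisprove seat)

The picked line `birth` (`Cruxes/SmoothToUniformizing/Lines/birth.lean`) cuts the crux
`SmoothToUniformizing` (ind-smooth valuation rings ⇒ relative local uniformization over perfect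
fields) at Néron's smoothness measure: `stub_valuativeJacobian` says that for `k` perfect, `K/k`
finitely generated, `O` a valuation subring of `K` and `B ⊆ O` a finitely generated `k`-subalgebra
with `Frac B = K`, flatness of `O ⊗_B Ω_{B/k}` over `O` forces `B` to be regular at the centre
`𝔪_O ∩ B`.

`stub_valuativeJacobian_false_without_flat` negates the SAME statement with the single hypothesis
`FlatKaehlerAlong B O h` (flatness of `O ⊗_B Ω_{B/k}`) DELETED — i.e. "every finitely generated model
of `K` inside `O` is regular at the centre" (written inline; nothing but theorems is declared under
`Summits/`). It is FALSE, sorry-free, by the monomial curve: `k = 𝔽_p` (perfect), `K = 𝔽_p(X)`,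
`O = 𝔽_p[X]_{(X)}` (the `X`-adic valuation ring), `B = k[X^{p+1}, X^p]` (for `p = 2` the cusp
`k[X², X³]`), `Frac B = K`. If `B` were regular at the centre `(X^p, X^{p+1})`, its local ring
`Λ ⊆ K` would be integrally closed (Matsumura 19.4, tree `isIntegrallyClosed_of_isRegularLocalRing`),
hence would contain `X` (`X^p ∈ B`), i.e. `X = a/s` with `a, s ∈ B`, `v_X(s) = 0`; but every
element of `B` is a polynomial without linear term — compare the coefficients of `X¹`.
(The argument is the one of `not_sameModel` in the standing disproof file of the sibling crux
`LuAlphaPTorsor`, `Cruxes/LuAlphaPTorsor/Disproof.lean` §4, transplanted to this stub.)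

Morals. (i) For the line: flatness of `O ⊗_B Ω_{B/k}` is exactly what separates stub 2 from the
false "every model is regular"; the stub's other hypotheses `(⊤ : IntermediateField k K).FG` and
`IsFractionRing B K` are, on paper, NOT needed (the rank count works with `trdeg_k Frac B`), while
`[PerfectField k]` IS (paper witness `B = k[x,y]/(x^p - t y^p)` over `k = 𝔽_p(t)`: `Ω_{B/k}` free,
`B` singular) — see `Cruxes/SmoothToUniformizing/Disproof.lean` §4. (ii) For the crux: its
conclusion `∃ A ⊇ R, …, A regular at the centre` cannot be sharpened to "`A := R` (or any prescribed
model) works" — the same witness with `R = B`; a proof must change the model.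
-/

set_option linter.dupNamespace false -- mandated namespace of this single-conjunct summit

namespace Summit.ResolutionOfSingularities.ResolutionOfSingularities.Theorems.SmoothToUniformizing.Negative

open Polynomial IsLocalRing
open Literature.AlgebraicGeometry.Resolution

/-- Every element of `k[X^(p+1), X^p] ⊆ k(X)` is a polynomial without linear term (`2 ≤ p`).
[folklore] -/
theorem exists_coeff_one_eq_zero_of_mem_adjoin {p : ℕ} (hp : 2 ≤ p) (k : Type) [Field k]
    {y : RatFunc k}
    (hy : y ∈ Algebra.adjoin k ({(RatFunc.X : RatFunc k) ^ (p + 1), RatFunc.X ^ p} :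
      Set (RatFunc k))) :
    ∃ q : k[X], q.coeff 1 = 0 ∧ algebraMap k[X] (RatFunc k) q = y := by
  induction hy using Algebra.adjoin_induction with
  | mem x hx =>
    rcases hx with rfl | rfl
    · refine ⟨X ^ (p + 1), ?_, by simp⟩
      rw [Polynomial.coeff_X_pow, if_neg]
      omega
    · refine ⟨X ^ p, ?_, by simp⟩
      rw [Polynomial.coeff_X_pow, if_neg]
      omega
  | algebraMap c => exact ⟨C c, Polynomial.coeff_C_succ, rfl⟩
  | add x y _ _ hx hy =>
    obtain ⟨qx, hqx, rfl⟩ := hx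
    obtain ⟨qy, hqy, rfl⟩ := hy
    exact ⟨qx + qy, by simp [hqx, hqy], by simp⟩
  | mul x y _ _ hx hy =>
    obtain ⟨qx, hqx, rfl⟩ := hx
    obtain ⟨qy, hqy, rfl⟩ := hy
    refine ⟨qx * qy, ?_, by simp⟩
    simp [Polynomial.coeff_mul, Finset.Nat.sum_antidiagonal_succ, hqx, hqy]

/-- **The flatness hypothesis of `stub_valuativeJacobian` (line `birth`) is load-bearing**: the stub
with `FlatKaehlerAlong B O h` deleted — "every finitely generated model `B ⊆ O` of `K` is regular at
the centre of `O`" (inline, verbatim otherwise) — is FALSE. Witness: `k = 𝔽_p`, `K = 𝔽_p(X)`, `O`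
the `X`-adic valuation ring, `B = k[X^(p+1), X^p]` (the cusp for `p = 2`): a regular local ring is
integrally closed, so `X` (with `X^p ∈ B`) would lie in `B` localised at the centre, `X = a/s`,
`a, s ∈ B`, `X ∤ s` — impossible, `B` has no linear terms. Equivalently: the crux's conclusion cannot
be sharpened to "the given model is already regular at the centre". [folklore] -/
theorem stub_valuativeJacobian_false_without_flat :
    ¬ (∀ (k K : Type) [Field k] [PerfectField k] [Field K] [Algebra k K],
        (⊤ : IntermediateField k K).FG →
        ∀ (O : ValuationSubring K) (B : Subalgebra k K) (h : B.toSubring ≤ O.toSubring),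
          B.FG → IsFractionRing B K →
          IsRegularLocalRing (Localization.AtPrime
            (Ideal.comap (Subring.inclusion h) (IsLocalRing.maximalIdeal O)))) := by
  classical
  intro H
  obtain ⟨p, hp⟩ : ∃ p : ℕ, p.Prime := ⟨2, Nat.prime_two⟩
  haveI : Fact p.Prime := ⟨hp⟩
  let k := ZMod p
  let K := RatFunc (ZMod p)
  let x : K := RatFunc.X
  let v : Valuation K (WithZero (Multiplicative ℤ)) := (Polynomial.idealX k).valuation K
  let O : ValuationSubring K := v.valuationSubring
  have hp0 : p ≠ 0 := hp.ne_zero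
  have hp2 : 2 ≤ p := hp.two_le
  -- polynomials lie in `O`
  have hpolyO : ∀ q : k[X], algebraMap k[X] K q ∈ O := fun q => by
    change v (algebraMap k[X] K q) ≤ 1
    rw [IsDedekindDomain.HeightOneSpectrum.valuation_of_algebraMap]
    exact IsDedekindDomain.HeightOneSpectrum.intValuation_le_one _ _
  have hxO : x ∈ O := by have := hpolyO X; rwa [RatFunc.algebraMap_X] at this
  have hkO : ∀ c : k, algebraMap k K c ∈ O := fun c => by
    have := hpolyO (C c); rwa [RatFunc.algebraMap_C] at this
  -- `K = k(X)` is finitely generated over `k`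
  have hKfg : (⊤ : IntermediateField k K).FG :=
    ⟨{RatFunc.X}, by rw [Finset.coe_singleton]; exact RatFunc.adjoin_X⟩
  -- the model `B = k[X^(p+1), X^p]`
  let B : Subalgebra k K := Algebra.adjoin k {x ^ (p + 1), x ^ p}
  have hBfg : B.FG := by
    simpa [B] using Subalgebra.fg_adjoin_finset ({x ^ (p + 1), x ^ p} : Finset K)
  have hBO : B.toSubring ≤ O.toSubring := by
    let Oalg : Subalgebra k K := { O.toSubring with algebraMap_mem' := hkO }
    change B ≤ Oalg
    refine Algebra.adjoin_le ?_
    rintro y (rfl | rfl)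
    · exact pow_mem hxO _
    · exact pow_mem hxO _
  -- `X^m ∈ B` for `m ≥ p²`, hence `X^(p²) · k[X] ⊆ B` and `Frac B = K`
  have hpow : ∀ q r : ℕ, r < p → x ^ (p ^ 2 + (p * q + r)) ∈ B := by
    intro q r hr
    induction q with
    | zero =>
      have hrp : r ≤ p := hr.le
      have : p ^ 2 + (p * 0 + r) = (p + 1) * r + p * (p - r) := by
        zify [hrp]; ring
      rw [this, pow_add, pow_mul, pow_mul]
      refine B.mul_mem (pow_mem ?_ _) (pow_mem ?_ _)
      · exact Algebra.subset_adjoin (by simp)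
      · exact Algebra.subset_adjoin (by simp)
    | succ q ih =>
      have : p ^ 2 + (p * (q + 1) + r) = p + (p ^ 2 + (p * q + r)) := by ring
      rw [this, pow_add]
      refine B.mul_mem ?_ ih
      exact Algebra.subset_adjoin (by simp)
  have hpow' : ∀ m : ℕ, x ^ (p ^ 2 + m) ∈ B := fun m => by
    have hm : m = p * (m / p) + m % p := (Nat.div_add_mod m p).symm
    rw [hm]
    exact hpow _ _ (Nat.mod_lt _ hp.pos)
  have hmul : ∀ q : k[X], x ^ (p ^ 2) * algebraMap k[X] K q ∈ B := by
    intro q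
    induction q using Polynomial.induction_on' with
    | add q₁ q₂ h₁ h₂ => rw [map_add, mul_add]; exact B.add_mem h₁ h₂
    | monomial n c =>
      rw [← Polynomial.C_mul_X_pow_eq_monomial, map_mul, map_pow, RatFunc.algebraMap_X,
        RatFunc.algebraMap_C, mul_left_comm, ← pow_add]
      have : (RatFunc.C c : K) = algebraMap k K c := rfl
      rw [this]
      exact B.mul_mem (B.algebraMap_mem c) (hpow' n)
  have hfr : IsFractionRing B K := by
    refine IsFractionRing.of_field B K fun z => ?_
    refine ⟨⟨_, hmul z.num⟩, ⟨_, hmul z.denom⟩, ?_⟩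
    have hx0 : (x ^ (p ^ 2) : K) ≠ 0 := pow_ne_zero _ RatFunc.X_ne_zero
    change z = (x ^ (p ^ 2) * algebraMap k[X] K z.num) / (x ^ (p ^ 2) * algebraMap k[X] K z.denom)
    rw [mul_div_mul_left _ _ hx0, RatFunc.num_div_denom]
  -- the mutated stub would make `B` regular at the centre
  have hregB := H k K hKfg O B hBO hBfg hfr
  -- then the local ring `Λ ⊆ K` of `B` at the centre is normal, so `X ∈ Λ`
  haveI : IsFractionRing B.toSubring K := hfr
  set Λ : Subalgebra B.toSubring K := Localization.subalgebra.ofField K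
    ((maximalIdeal O).comap (Subring.inclusion hBO)).primeCompl
    (Ideal.primeCompl_le_nonZeroDivisors _) with hΛ
  have hregΛ : IsRegularLocalRing Λ :=
    (isRegularLocalRing_iff_centreLocalization O B hBO).mp hregB
  haveI : IsIntegrallyClosed Λ := isIntegrallyClosed_of_isRegularLocalRing Λ
  have hxΛ : x ∈ Λ := by
    have hxpΛ : x ^ p ∈ Λ :=
      le_centreLocalization O B hBO (Algebra.subset_adjoin (by simp))
    have hint : IsIntegral Λ x :=
      ⟨Polynomial.X ^ p - Polynomial.C ⟨x ^ p, hxpΛ⟩, Polynomial.monic_X_pow_sub_C _ hp0, by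
        simp [Polynomial.eval₂_sub, Polynomial.eval₂_X_pow, Polynomial.eval₂_C]⟩
    obtain ⟨y, hy⟩ := IsIntegrallyClosed.algebraMap_eq_of_integral hint
    rw [← hy]
    exact y.2
  -- write `X = a / s` with `a, s ∈ B`, `v(s) = 1`
  rw [hΛ, mem_centreLocalization_iff] at hxΛ
  obtain ⟨a, ha, s, hs, hs1, hxas⟩ := hxΛ
  obtain ⟨qa, hqa1, rfl⟩ := exists_coeff_one_eq_zero_of_mem_adjoin hp2 k ha
  obtain ⟨qs, hqs1, rfl⟩ := exists_coeff_one_eq_zero_of_mem_adjoin hp2 k hs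
  -- `v(s) = 1` says `X ∤ qs`, i.e. `qs(0) ≠ 0`
  have hqs0 : qs.coeff 0 ≠ 0 := by
    have hv1 : v (algebraMap k[X] K qs) = 1 :=
      (Valuation.isEquiv_valuation_valuationSubring v).eq_one_iff_eq_one.mpr hs1
    rw [IsDedekindDomain.HeightOneSpectrum.valuation_of_algebraMap,
      IsDedekindDomain.HeightOneSpectrum.intValuation_eq_one_iff, Polynomial.idealX_span,
      Ideal.mem_span_singleton, Polynomial.X_dvd_iff] at hv1
    exact hv1
  -- `X * qs = qa`: compare the coefficients of `X¹`
  have hs0 : algebraMap k[X] K qs ≠ 0 := by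
    intro h0
    rw [h0, map_zero] at hs1
    exact zero_ne_one hs1
  have heqK : algebraMap k[X] K (X * qs) = algebraMap k[X] K qa := by
    rw [map_mul, RatFunc.algebraMap_X]
    change x * _ = _
    rw [hxas, inv_mul_cancel_right₀ hs0]
  have heq : X * qs = qa := RatFunc.algebraMap_injective k heqK
  have := congrArg (fun q : k[X] => q.coeff 1) heq
  simp only [Polynomial.coeff_X_mul, hqa1] at this
  exact hqs0 this

end Summit.ResolutionOfSingularities.ResolutionOfSingularities.Theorems.SmoothToUniformizing.Negative
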